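import Summits.AtomisticToContinuum.BoseEinsteinCondensation.Theorems.BECThomsonPrincipleGDTransferSeededPlainCostCore

/-!
# Route `BECThomsonPrinciple`, crux `GDTransfer` (stmt-AtomisticToContinuum-9482), line `seeded-continuity`:
# stub `stub_plainPairCost`, part 4 — the near-minimiser assembly (closes the registered stub)

`theorem stub_plainPairCost : Sig.stub_plainPairCost`, i.e. `PlainKineticIdentity → PlainInteractionBound →
PlainPairCost`: the Kennedy–Lieb–Shastry second variation of the PLAIN pair `ζ₊ = N^{-1/2}a_n†a₀Ψ`,
`ζ₋ = N^{-1/2}a₀†a_nΨ` at a `δ`-near-minimiser `Ψ`,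

  `𝓔(ζ₊) + 𝓔(ζ₋) ≤ E₀(‖ζ₊‖² + ‖ζ₋‖²) + (5k² + c₂ρ)(1 + ‖ζ₊‖² + ‖ζ₋‖²)`,  `k = 2π‖n‖_∞/L`, `ρ = N/L³`,

with `c₂ = C_I(1 + √(‖v‖₁ + 1)) + 2` (`C_I` the constant of `PlainInteractionBound`).  Assembly of the landed parts:
the double-commutator estimate at a state (`PlainCost.core_estimate`, part 3) bounds `𝓔(ζ₊) + 𝓔(ζ₋) − E₀(‖ζ₊‖² + ‖ζ₋‖²)`
by `(2π/L)²|n|₂²(‖ζ₊‖² − ‖ζ₋‖²) + 𝒟^V(Ψ) + √(𝓔(ζ₋ζ₊Ψ)q̃(Ψ)) + √(𝓔(ζ₊ζ₋Ψ)q̃(Ψ))`; then (kin) `|n|₂² ≤ 3‖n‖_∞²`,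
(int) `|𝒟^V| ≤ C_I(ρ + √(ρE(Ψ)/N)) ≤ C_I(1 + √(‖v‖₁+1))ρ` because `E(Ψ) ≤ E₀ + δ ≤ N²L⁻³(‖v‖₁ + 1)` (constant trial
state, part 2), and (cross) `𝓔(ζ∓ζ±Ψ) ≤ K²(E₀ + 3)(1 + ‖n‖²)` by the a-priori budgets (`PlainAlgebra.exists_apriori_const`)
while `q̃(Ψ) ≤ δ`, so that the slack `δ = min(1, N²/L³, ε²/(K²(E₀+3)+1))`, `ε = min(ρ, (2π/L)²)`, makes each cross term
`≤ (1 + ‖n‖²)ε ≤ ρ + k²`.  All [folklore] (KennedyLiebShastry1988 (12)–(14); PitaevskiiStringari1991; LSSY2005 App. A).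
-/

noncomputable section

open MeasureTheory Filter
open scoped ENNReal NNReal ComplexConjugate

namespace Summit.AtomisticToContinuum.BoseEinsteinCondensation.Cruxes.GDTransfer.Seeded

namespace PlainCost

open Literature.MathematicalPhysics.QuantumManyBody.BoseGas
open Summit.AtomisticToContinuum.BoseEinsteinCondensation.Cruxes.GDTransfer.DysonDressedWitness

variable {m : ℕ} {L : ℝ} {v : ℝ → ℝ≥0∞}

/-! ## Bookkeeping: `ℝ≥0∞` budgets read in `ℝ` -/

/-- `e ≤ K·M` with `K, M < ∞` read in `ℝ`. [folklore] -/
theorem toReal_le_of_le_mul {e K M : ℝ≥0∞} (hK : K ≠ ⊤) (hM : M ≠ ⊤) (h : e ≤ K * M) :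
    e ≠ ⊤ ∧ e.toReal ≤ K.toReal * M.toReal := by
  refine ⟨ne_top_of_le_ne_top (ENNReal.mul_ne_top hK hM) h, ?_⟩
  rw [← ENNReal.toReal_mul]
  exact ENNReal.toReal_mono (ENNReal.mul_ne_top hK hM) h

/-- The a-priori energy budget `e ≤ K(P + (1 + q)M)` with `K, P, M < ∞` read in `ℝ`. [folklore] -/
theorem toReal_le_of_le_budget {e K P M : ℝ≥0∞} {q : ℝ} (hK : K ≠ ⊤) (hP : P ≠ ⊤) (hM : M ≠ ⊤) (hq : 0 ≤ q)
    (h : e ≤ K * (P + (1 + ENNReal.ofReal q) * M)) :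
    e ≠ ⊤ ∧ e.toReal ≤ K.toReal * (P.toReal + (1 + q) * M.toReal) := by
  have h1 : (1 + ENNReal.ofReal q) * M ≠ ⊤ :=
    ENNReal.mul_ne_top (ENNReal.add_ne_top.2 ⟨ENNReal.one_ne_top, ENNReal.ofReal_ne_top⟩) hM
  have hR : K * (P + (1 + ENNReal.ofReal q) * M) ≠ ⊤ := ENNReal.mul_ne_top hK (ENNReal.add_ne_top.2 ⟨hP, h1⟩)
  refine ⟨ne_top_of_le_ne_top hR h, ?_⟩
  have h' := ENNReal.toReal_mono hR h
  rwa [ENNReal.toReal_mul, ENNReal.toReal_add hP h1, ENNReal.toReal_mul,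
    ENNReal.toReal_add ENNReal.one_ne_top ENNReal.ofReal_ne_top, ENNReal.toReal_one,
    ENNReal.toReal_ofReal hq] at h'

/-- Back to `ℝ≥0∞`: a real inequality `A + B ≤ E(M₁ + M₂) + c(1 + M₁ + M₂)` between the `toReal`s of finite
quantities, `c ≥ 0`, is the `ℝ≥0∞` inequality `A + B ≤ E(M₁ + M₂) + ofReal (c(1 + (M₁ + M₂).toReal))`. [folklore] -/
theorem add_le_of_toReal_le {A B E M₁ M₂ : ℝ≥0∞} {c : ℝ} (hA : A ≠ ⊤) (hB : B ≠ ⊤) (hE : E ≠ ⊤) (hM₁ : M₁ ≠ ⊤)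
    (hM₂ : M₂ ≠ ⊤) (hc : 0 ≤ c)
    (h : A.toReal + B.toReal ≤ E.toReal * (M₁.toReal + M₂.toReal) + c * (1 + (M₁.toReal + M₂.toReal))) :
    A + B ≤ E * (M₁ + M₂) + ENNReal.ofReal (c * (1 + (M₁ + M₂).toReal)) := by
  have hM : (M₁ + M₂).toReal = M₁.toReal + M₂.toReal := ENNReal.toReal_add hM₁ hM₂
  have h0 : 0 ≤ E.toReal * (M₁.toReal + M₂.toReal) := by positivity
  have h0' : 0 ≤ c * (1 + (M₁.toReal + M₂.toReal)) := by positivity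
  calc A + B = ENNReal.ofReal (A.toReal + B.toReal) := by
        rw [ENNReal.ofReal_add ENNReal.toReal_nonneg ENNReal.toReal_nonneg, ENNReal.ofReal_toReal hA,
          ENNReal.ofReal_toReal hB]
    _ ≤ ENNReal.ofReal (E.toReal * (M₁.toReal + M₂.toReal) + c * (1 + (M₁.toReal + M₂.toReal))) :=
        ENNReal.ofReal_le_ofReal h
    _ = E * (M₁ + M₂) + ENNReal.ofReal (c * (1 + (M₁ + M₂).toReal)) := by
        rw [ENNReal.ofReal_add h0 h0', ENNReal.ofReal_mul ENNReal.toReal_nonneg, ENNReal.ofReal_toReal hE, ← hM,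
          ENNReal.ofReal_toReal (ENNReal.add_ne_top.2 ⟨hM₁, hM₂⟩)]

/-! ## Elementary real estimates -/

/-- `Σ_i n_i² ≤ 3‖n‖_∞²` on `ℤ³`. [folklore] -/
theorem sum_sq_le_three_mul_norm_sq (n : Fin 3 → ℤ) :
    (∑ i : Fin 3, ((n i : ℝ)) ^ 2) ≤ 3 * ‖(fun j => (n j : ℝ))‖ ^ 2 := by
  -- adapted from `ir_psq_le_three_kinf_sq` (…DensityResponseInfraredEquiv)
  have hcoord : ∀ i, (n i : ℝ) ^ 2 ≤ ‖(fun j => (n j : ℝ))‖ ^ 2 := fun i => by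
    rw [← sq_abs, ← Real.norm_eq_abs]
    exact pow_le_pow_left₀ (norm_nonneg _) (norm_le_pi_norm (fun j => (n j : ℝ)) i) 2
  calc ∑ i, (n i : ℝ) ^ 2 ≤ ∑ _i : Fin 3, ‖(fun j => (n j : ℝ))‖ ^ 2 := Finset.sum_le_sum fun i _ => hcoord i
    _ = 3 * ‖(fun j => (n j : ℝ))‖ ^ 2 := by simp

/-- The cross term under the slack: `0 ≤ X ≤ A(1+q)`, `Q ≤ δ`, `Aδ ≤ ε²` give `√(XQ) ≤ (1+q)ε`. [folklore] -/
theorem sqrt_mul_le_of_slack {X Q A q δ ε : ℝ} (hX0 : 0 ≤ X) (hX : X ≤ A * (1 + q)) (hQ : Q ≤ δ) (hδ : 0 ≤ δ)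
    (hA : A * δ ≤ ε ^ 2) (hε : 0 ≤ ε) (hq : 0 ≤ q) : Real.sqrt (X * Q) ≤ (1 + q) * ε := by
  have h1 : X * Q ≤ X * δ := mul_le_mul_of_nonneg_left hQ hX0
  have h2 : X * δ ≤ A * (1 + q) * δ := mul_le_mul_of_nonneg_right hX hδ
  have h3 : A * (1 + q) * δ ≤ (1 + q) * ε ^ 2 := by
    have := mul_le_mul_of_nonneg_left hA (by linarith : (0 : ℝ) ≤ 1 + q)
    linarith [this]
  have h4 : (1 + q) * ε ^ 2 ≤ ((1 + q) * ε) ^ 2 := by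
    nlinarith [mul_nonneg hq (sq_nonneg ε), mul_nonneg (mul_nonneg hq hq) (sq_nonneg ε)]
  calc Real.sqrt (X * Q) ≤ Real.sqrt (((1 + q) * ε) ^ 2) := Real.sqrt_le_sqrt (by linarith)
    _ = (1 + q) * ε := Real.sqrt_sq (by positivity)

/-- The interaction term under the energy bound: `E ≤ Nρ(ν+1)` gives `√(ρE/N) ≤ ρ√(ν+1)`. [folklore] -/
theorem sqrt_div_le_of_energy {ρ E N ν : ℝ} (hρ : 0 ≤ ρ) (hN : 0 < N) (hE : E ≤ N * ρ * (ν + 1)) :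
    Real.sqrt (ρ * E / N) ≤ ρ * Real.sqrt (ν + 1) := by
  have h1 : ρ * E / N ≤ ρ ^ 2 * (ν + 1) := by
    rw [div_le_iff₀ hN]
    calc ρ * E ≤ ρ * (N * ρ * (ν + 1)) := mul_le_mul_of_nonneg_left hE hρ
      _ = ρ ^ 2 * (ν + 1) * N := by ring
  calc Real.sqrt (ρ * E / N) ≤ Real.sqrt (ρ ^ 2 * (ν + 1)) := Real.sqrt_le_sqrt h1
    _ = ρ * Real.sqrt (ν + 1) := by rw [Real.sqrt_mul (sq_nonneg ρ), Real.sqrt_sq hρ]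

end PlainCost

open Literature.MathematicalPhysics.QuantumManyBody.BoseGas in
open Summit.AtomisticToContinuum.BoseEinsteinCondensation.Cruxes.GDTransfer.DysonDressedWitness in
/-- **`stub_plainPairCost` (registered stub of skeleton v3, line `seeded-continuity`)**: the exact kinetic identity and
the state-independent interaction double commutator of the plain pair imply its Kennedy–Lieb–Shastry second variation
at near-minimisers, `𝓔(ζ₊) + 𝓔(ζ₋) ≤ E₀(‖ζ₊‖² + ‖ζ₋‖²) + (5k² + c₂ρ)(1 + ‖ζ₊‖² + ‖ζ₋‖²)` with `c₂ = C_I(1 + √(‖v‖₁+1)) + 2`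
and a slack `δ = δ(v, N, L) > 0`. [folklore] (KennedyLiebShastry1988; PitaevskiiStringari1991; LSSY2005 App. A) -/
theorem stub_plainPairCost : Sig.stub_plainPairCost := by
  intro hK hI v hv hfc
  obtain ⟨C_I, hC_I, hIb⟩ := hI v hv hfc
  have hint : (∫⁻ x : Space, v ‖x‖) ≠ ⊤ := lintegral_ne_top_of_isFiniteContinuous hv hfc
  have hnv : 0 ≤ (∫⁻ x : Space, v ‖x‖).toReal := ENNReal.toReal_nonneg
  refine ⟨5, C_I * (1 + Real.sqrt ((∫⁻ x : Space, v ‖x‖).toReal + 1)) + 2, by norm_num, by positivity, ?_⟩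
  intro m L hL hE0
  obtain ⟨K, hKtop, hKb⟩ := PlainAlgebra.exists_apriori_const (L := L) hL hv.1 hint m
  -- the ground-state energy per volume: `E₀ ≤ N²L⁻³‖v‖₁`
  have he₀ : (periodicGroundStateEnergy v (m + 1) L).toReal ≤
      ((m + 1 : ℕ) : ℝ) ^ 2 / L ^ 3 * (∫⁻ x : Space, v ‖x‖).toReal := by
    have h := ENNReal.toReal_mono (ENNReal.mul_ne_top ENNReal.ofReal_ne_top hint)
      (PlainCost.periodicGroundStateEnergy_le_const hv.1 m hL)
    rw [ENNReal.toReal_mul, ENNReal.toReal_ofReal (by positivity)] at h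
    have hc : ((m + 1 : ℕ) : ℝ) = (m : ℝ) + 1 := by push_cast; ring
    rwa [hc]
  -- positivity of the data at `(N, L)`
  have hN : (0 : ℝ) < ((m + 1 : ℕ) : ℝ) := by positivity
  have hL3 : (0 : ℝ) < L ^ 3 := by positivity
  have hρ : (0 : ℝ) < ((m + 1 : ℕ) : ℝ) / L ^ 3 := div_pos hN hL3
  have hk0 : (0 : ℝ) < (2 * Real.pi / L) ^ 2 := by positivity
  have he₀0 : 0 ≤ (periodicGroundStateEnergy v (m + 1) L).toReal := ENNReal.toReal_nonneg
  have hKr : 0 ≤ K.toReal := ENNReal.toReal_nonneg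
  -- the slack `δ = min (1, N²/L³, ε²/(K²(e₀+3)+1))`, `ε = min (ρ, (2π/L)²)`
  set ε : ℝ := min (((m + 1 : ℕ) : ℝ) / L ^ 3) ((2 * Real.pi / L) ^ 2) with hεdef
  have hε : 0 < ε := lt_min hρ hk0
  have hερ : ε ≤ ((m + 1 : ℕ) : ℝ) / L ^ 3 := min_le_left _ _
  have hεk : ε ≤ (2 * Real.pi / L) ^ 2 := min_le_right _ _
  set δr : ℝ := min 1 (min (((m + 1 : ℕ) : ℝ) ^ 2 / L ^ 3)
    (ε ^ 2 / (K.toReal ^ 2 * ((periodicGroundStateEnergy v (m + 1) L).toReal + 3) + 1))) with hδrdef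
  have hδr : 0 < δr := lt_min one_pos (lt_min (by positivity) (by positivity))
  have hδ1 : δr ≤ 1 := min_le_left _ _
  have hδN : δr ≤ ((m + 1 : ℕ) : ℝ) ^ 2 / L ^ 3 := (min_le_right _ _).trans (min_le_left _ _)
  have hδε : K.toReal ^ 2 * ((periodicGroundStateEnergy v (m + 1) L).toReal + 3) * δr ≤ ε ^ 2 := by
    have h1 : δr ≤ ε ^ 2 / (K.toReal ^ 2 * ((periodicGroundStateEnergy v (m + 1) L).toReal + 3) + 1) :=
      (min_le_right _ _).trans (min_le_right _ _)
    rw [le_div_iff₀ (by positivity)] at h1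
    linarith only [h1, hδr.le]
  refine ⟨ENNReal.ofReal δr, ENNReal.ofReal_pos.2 hδr, ?_⟩
  intro Ψ hΨ n
  -- the state
  have hψ : IsDirection m L Ψ.ψ := isDirection_trialState Ψ
  have hmass : mass L Ψ.ψ = 1 := mass_trialState Ψ
  have hEtop : periodicEnergy v Ψ ≠ ⊤ :=
    ne_top_of_le_ne_top (ENNReal.add_ne_top.2 ⟨hE0, ENNReal.ofReal_ne_top⟩) hΨ
  have hψe : eform v L Ψ.ψ ≠ ⊤ := by rw [eform_trialState]; exact hEtop
  have h1top : mass L Ψ.ψ ≠ ⊤ := by rw [hmass]; exact ENNReal.one_ne_top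
  have hq0 : 0 ≤ ‖(fun j => (n j : ℝ))‖ ^ 2 := sq_nonneg _
  -- a-priori budgets of `a = ζ₊Ψ`, `b = ζ₋Ψ`, `ζ₋a`, `ζ₊b`, read in `ℝ`
  obtain ⟨hma, hmb, hea, heb⟩ := hKb n Ψ.ψ Ψ.contDiff
  obtain ⟨-, -, -, heDU⟩ := hKb n (plainUp m L n Ψ.ψ) (PlainAlgebra.contDiff_plainUp n Ψ.contDiff)
  obtain ⟨-, -, heUD, -⟩ := hKb n (plainDown m L n Ψ.ψ) (PlainAlgebra.contDiff_plainDown n Ψ.contDiff)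
  obtain ⟨hmatop, hMa⟩ := PlainCost.toReal_le_of_le_mul hKtop h1top hma
  obtain ⟨hmbtop, hMb⟩ := PlainCost.toReal_le_of_le_mul hKtop h1top hmb
  obtain ⟨hae, hEa⟩ := PlainCost.toReal_le_of_le_budget hKtop hψe h1top hq0 hea
  obtain ⟨hbe, hEb⟩ := PlainCost.toReal_le_of_le_budget hKtop hψe h1top hq0 heb
  obtain ⟨hDUe, hEDU⟩ := PlainCost.toReal_le_of_le_budget hKtop hae hmatop hq0 heDU
  obtain ⟨hUDe, hEUD⟩ := PlainCost.toReal_le_of_le_budget hKtop hbe hmbtop hq0 heUD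
  rw [hmass, ENNReal.toReal_one, mul_one] at hMa hMb hEa hEb
  rw [eform_trialState v Ψ] at hEa hEb
  have hMa0 : 0 ≤ (mass L (plainUp m L n Ψ.ψ)).toReal := ENNReal.toReal_nonneg
  have hMb0 : 0 ≤ (mass L (plainDown m L n Ψ.ψ)).toReal := ENNReal.toReal_nonneg
  have hEDU0 : 0 ≤ (eform v L (plainDown m L n (plainUp m L n Ψ.ψ))).toReal := ENNReal.toReal_nonneg
  have hEUD0 : 0 ≤ (eform v L (plainUp m L n (plainDown m L n Ψ.ψ))).toReal := ENNReal.toReal_nonneg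
  have hE0' : 0 ≤ (periodicEnergy v Ψ).toReal := ENNReal.toReal_nonneg
  -- the near-minimiser: `E ≤ e₀ + δ`
  have hEle : (periodicEnergy v Ψ).toReal ≤ (periodicGroundStateEnergy v (m + 1) L).toReal + δr := by
    have h := ENNReal.toReal_mono (ENNReal.add_ne_top.2 ⟨hE0, ENNReal.ofReal_ne_top⟩) hΨ
    rwa [ENNReal.toReal_add hE0 ENNReal.ofReal_ne_top, ENNReal.toReal_ofReal hδr.le] at h
  -- the core estimate and the interaction bound at the state; `Σ n_i² ≤ 3‖n‖²`
  have core := PlainCost.core_estimate hK hv.1 hL n hψ hψe hae hbe hUDe hDUe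
  rw [hmass, ENNReal.toReal_one, mul_one, eform_trialState v Ψ] at core
  have hint' := (le_abs_self _).trans (hIb m L hL n Ψ hEtop)
  have hS := PlainCost.sum_sq_le_three_mul_norm_sq n
  have hS0 : 0 ≤ ∑ i : Fin 3, ((n i : ℝ)) ^ 2 := Finset.sum_nonneg fun i _ => sq_nonneg _
  -- pass to `ℝ` and name the quantities
  refine PlainCost.add_le_of_toReal_le hae hbe hE0 hmatop hmbtop (by positivity) ?_
  have hk : (2 * Real.pi * ‖(fun j => (n j : ℝ))‖ / L) ^ 2 =
      (2 * Real.pi / L) ^ 2 * ‖(fun j => (n j : ℝ))‖ ^ 2 := by ring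
  rw [hk]
  set N : ℝ := ((m + 1 : ℕ) : ℝ) with hNdef
  set nv : ℝ := (∫⁻ x : Space, v ‖x‖).toReal with hnvdef
  set e₀ : ℝ := (periodicGroundStateEnergy v (m + 1) L).toReal with he₀def
  set Kr : ℝ := K.toReal with hKrdef
  set k0 : ℝ := (2 * Real.pi / L) ^ 2 with hk0def
  set ρ : ℝ := N / L ^ 3 with hρdef
  set E : ℝ := (periodicEnergy v Ψ).toReal with hEdef
  set q : ℝ := ‖(fun j => (n j : ℝ))‖ ^ 2 with hqdef
  set Ma : ℝ := (mass L (plainUp m L n Ψ.ψ)).toReal with hMadef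
  set Mb : ℝ := (mass L (plainDown m L n Ψ.ψ)).toReal with hMbdef
  set Ea : ℝ := (eform v L (plainUp m L n Ψ.ψ)).toReal with hEadef
  set Eb : ℝ := (eform v L (plainDown m L n Ψ.ψ)).toReal with hEbdef
  set EDU : ℝ := (eform v L (plainDown m L n (plainUp m L n Ψ.ψ))).toReal with hEDUdef
  set EUD : ℝ := (eform v L (plainUp m L n (plainDown m L n Ψ.ψ))).toReal with hEUDdef
  set S : ℝ := ∑ i : Fin 3, ((n i : ℝ)) ^ 2 with hSdef
  set D : ℝ := plainInteractionDefect v m L n Ψ.ψ with hDdef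
  -- (kin) `(2π/L)² Σn_i² (Ma − Mb) ≤ 3k²(Ma + Mb)`
  have kin : k0 * S * (Ma - Mb) ≤ 3 * (k0 * q) * (Ma + Mb) := by
    have f1 : 0 ≤ k0 * S * Mb := by positivity
    have f2 : k0 * Ma * S ≤ k0 * Ma * (3 * q) := mul_le_mul_of_nonneg_left hS (by positivity)
    have f3 : 0 ≤ k0 * q * Mb := by positivity
    linarith only [f1, f2, f3]
  -- (int) `𝒟^V ≤ C_I(1 + √(‖v‖₁+1)) ρ`
  have hEN : E ≤ N * ρ * (nv + 1) := by
    have h1 : N ^ 2 / L ^ 3 = N * ρ := by rw [hρdef]; ring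
    have h2 : e₀ ≤ N * ρ * nv := by rw [← h1]; exact he₀
    have h3 : δr ≤ N * ρ := by rw [← h1]; exact hδN
    linarith only [hEle, h2, h3, hnv]
  have int : D ≤ C_I * (1 + Real.sqrt (nv + 1)) * ρ := by
    have h1 := PlainCost.sqrt_div_le_of_energy hρ.le hN hEN
    have h2 : C_I * (ρ + Real.sqrt (ρ * E / N)) ≤ C_I * (ρ + ρ * Real.sqrt (nv + 1)) :=
      mul_le_mul_of_nonneg_left (by linarith only [h1]) hC_I.le
    calc D ≤ C_I * (ρ + Real.sqrt (ρ * E / N)) := hint'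
      _ ≤ C_I * (ρ + ρ * Real.sqrt (nv + 1)) := h2
      _ = C_I * (1 + Real.sqrt (nv + 1)) * ρ := by ring
  -- (cross) `√(𝓔(ζ∓ζ±Ψ) q̃(Ψ)) ≤ ρ + k²`
  have hQ : E - e₀ ≤ δr := by linarith only [hEle]
  have hbud : ∀ {X Y M : ℝ}, 0 ≤ M → X ≤ Kr * (Y + (1 + q) * M) → Y ≤ Kr * (E + (1 + q)) → M ≤ Kr →
      X ≤ Kr ^ 2 * (e₀ + 3) * (1 + q) := by
    intro X Y M hM hX hY hM'
    have h1 : (1 + q) * M ≤ (1 + q) * Kr := mul_le_mul_of_nonneg_left hM' (by linarith only [hq0])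
    have h2 : Y + (1 + q) * M ≤ Kr * (E + (1 + q)) + (1 + q) * Kr := by linarith only [h1, hY]
    have h3 : Kr * (Y + (1 + q) * M) ≤ Kr * (Kr * (E + (1 + q)) + (1 + q) * Kr) :=
      mul_le_mul_of_nonneg_left h2 hKr
    have h4 : E + (1 + q) + (1 + q) ≤ (e₀ + 3) * (1 + q) := by
      linarith only [hEle, hδ1, mul_nonneg he₀0 hq0, hq0]
    have h5 : Kr * (Kr * (E + (1 + q)) + (1 + q) * Kr) ≤ Kr ^ 2 * (e₀ + 3) * (1 + q) := by
      linarith only [mul_le_mul_of_nonneg_left h4 (mul_nonneg hKr hKr)]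
    linarith only [hX, h3, h5]
  have cross1 : Real.sqrt (EDU * (E - e₀)) ≤ ρ + k0 * q := by
    have h := PlainCost.sqrt_mul_le_of_slack hEDU0 (hbud hMa0 hEDU hEa hMa) hQ hδr.le hδε hε.le hq0
    have h2 : q * ε ≤ q * k0 := mul_le_mul_of_nonneg_left hεk hq0
    linarith only [h, hερ, h2]
  have cross2 : Real.sqrt (EUD * (E - e₀)) ≤ ρ + k0 * q := by
    have h := PlainCost.sqrt_mul_le_of_slack hEUD0 (hbud hMb0 hEUD hEb hMb) hQ hδr.le hδε hε.le hq0
    have h2 : q * ε ≤ q * k0 := mul_le_mul_of_nonneg_left hεk hq0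
    linarith only [h, hερ, h2]
  -- total
  have g1 : 0 ≤ k0 * q * (Ma + Mb) := by positivity
  have g2 : 0 ≤ (C_I * (1 + Real.sqrt (nv + 1)) + 2) * ρ * (Ma + Mb) := by positivity
  have g3 : 0 ≤ k0 * q := by positivity
  linarith only [core, kin, int, cross1, cross2, g1, g2, g3]

end Summit.AtomisticToContinuum.BoseEinsteinCondensation.Cruxes.GDTransfer.Seeded

end
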